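import Literature.MathematicalPhysics.QuantumFieldTheory.Balaban1983to89.B8SectEInLambdaWitnessRec
import Literature.MathematicalPhysics.QuantumFieldTheory.Balaban1983to89.B8SectEKLevelInLambda

/-!
# `Balaban1983to89.B8SectEKLevelInLambdaRec` — RECORD TWIN of `B8SectEKLevelInLambda` ([Balaban1985RegularSpaces] Sect. E pp. 95–97: «exactly one solution of
# Eq. (1.117)», `D′(λ)`, (1.114) and the Lipschitz property at `k` levels, WITNESS FORM, and at the INVERSE `u₁⁻¹` of Theorem 4's inductive gauge transformation)
# FOR THE SYMMETRISED CENTRED block averaging (0.4) of [Balaban1987RG1]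

statement-level skeleton of published theorems with citation tags; proofs where landed; nothing here is a claim about the Yang–Mills mass gap

T. Bałaban, *Spaces of regular gauge field configurations on a lattice and gauge fixing conditions*, Commun. Math. Phys. **99** (1985) 75–102
`[Balaban1985RegularSpaces]` ("[6]"): (1.112)–(1.125) pp. 95–97; T. Bałaban, *Averaging operations for lattice gauge theories*, Commun. Math. Phys. **98** (1985) 17–51
`[Balaban1985Averaging]` ("[3]"): Prop. 10 p. 50, (166)–(167) p. 44; T. Bałaban, *Renormalization group approach to lattice gauge field theories. I*, Commun. Math. Phys.
**109** (1987) 249–301 `[Balaban1987RG1]` ("[I]"): (0.3)–(0.4) pp. 252–253.  STATUS: published, refereed.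

CITATION HEADER (lean-in-tree rule).  Cell `pub-ymgap`, «N05-REC» stage 2 (director-ym №254∕№255∕№288), item R5-γ (Sect. E for the record; dag-n05-c's remainder list, HANDOFF g26)
— typed by the LEAD PEN dag-n05-e g39 (inventory `N05-REC-INVENTORY.md` §R5 row `B8SectEKLevelInLambda`: A `Dprime_lipschitz_kLevel_inv_of_axial`, `Dprime_lipschitz_kLevel_w`,
`Dprime_diff_le_kLevel_w`, `exists_Dprime_kLevel_inv_of_axial`, `exists_Dprime_kLevel_w`, `eq1117_existsUnique_kLevel_w`, `norm_Dprime_le_kLevel_w`; + the private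
`contraction_core ∕ fixed_iff_pointwise` and `eq1117_solution_mem_of_invariant_w`).  WHAT IS REPRODUCED = ✓ the engine module `B8SectEKLevelInLambda`
(seat `pub-ymgap-dag-n04-b` g3, proofs = dag-n05-b's `B8Eq1117KLevel` ∕ `B8DprimeKLevelLipschitz`) §1–§4 VERBATIM under the token map, minus the `{Ω_j}`-family corollary
`exists_Dprime_kLevel_inv_of_domainSeq` (off the crown's cone).  THEOREM NAMES = the engine's (namespace `…B8SectEKLevelInLambdaRec`; dag-n05-c's R5 convention, cf.
`B8Eq1117KLevelRec.eq1114_of_fixedPoint_kLevel`).  TOKEN MAP: `Cnl ∕ Qnl ∕ InLambda ∕ InAx ∕ Restr129 ↦ CnlZ ∕ QnlZ ∕ InLambdaZ ∕ InAxZ ∕ Restr129Z`,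
`QprimeIter (zdBlocking d L) (bgT L U₀) ↦ QprimeIter (zdBlockingZ d L) (bgTZ L U₀)`; tower `B8Ineq130.tlo ∕ thi ↦ B8Ineq130Rec.tlo ∕ thi` (CENTRED); regime `(hL : 2 ≤ L) ↦
(hLs : L = 2s+1) (hs1 : 1 ≤ s) (hd : 1 ≤ d)`, `C0 ↦ C0Z`; §4's witness constant `40d·c ↦ 20dKZ·c` with the record smallness (`exp(4c_Zα₀)(1 + 2·131072(d+1)²KZ²c) ≤ 2`,
`KZ·c ≤ c₃`, `1024·d·KZ·c ≤ 1`); the two Sect.-E point lemmas are `B8SectEInLambdaWitnessRec.norm_CnlZ_le_tower_of_witness ∕ lipschitz_CnlZ_tower_of_witness`, the inverse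
witness `…witness_inv_of_axialZ`.  Structure-free inputs REUSED BY NAME: `B8Eq1117KLevel.dom120_of_119_tower`, `B8SectDSource.fixedPoint_closedBall ∕ fixedPoint_mem_of_invariant`,
`B8Eq1122Concrete.cjDiff_sub`, `B8Eq1117Concrete.XSpace`, `B8Ineq125Concrete.C2p`; record (1.114): `B8Eq1117KLevelRec.eq1114_of_fixedPoint_kLevel`.  Kind «kernel-checked proof»,
theorems only; no `def`, no `instance`, no `notation`, no existing module modified.  `--supports stmt-QuantumFields-20541` (K0⁷-keyed, COUNT-NEUTRAL).

## WHAT IS CERTIFIED HERE (kernel; axioms `propext` ∕ `Classical.choice` ∕ `Quot.sound`)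
Hypotheses per `(j, y ∈ Λ_j)`, `j ≤ k`, ON THE CENTRED TOWER `Bʲ(y)` ONLY: (1.33) `pdevOn … U₀ < α₀L^{−2j}`; a `Λ_j`-witness for `u₁` with constant `α₃` (`InLambdaZ`); (1.119) for `λ` at
scale `L^{−j}`; the `H′`-modulus `B′₀‖X‖L^{−j}`; globally `‖(H′X)(x)‖ ≤ B′₀‖X‖`; windows in `α₃` and print's «α₃ + α₄ ≦ 1/(4B′₀C′₂)» (`C′₂ := 2·C2p`).
* §1 `eq1117_existsUnique_kLevel_w`, `eq1117_solution_mem_of_invariant_w` — exactly one solution of (1.117) in the ball, record structure; invariant closed sets.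
* §2 `norm_Dprime_le_kLevel_w`, `exists_Dprime_kLevel_w` — `D′(λ)` + (1.114) on `𝔅_k`, record structure.
* §3 `Dprime_diff_le_kLevel_w`, `Dprime_lipschitz_kLevel_w` (the structure-free `smallness_prod_w` reused by name) — `D′` Lipschitz in `λ`, record structure.
* §4 (C⋆, unitary data) `exists_Dprime_kLevel_inv_of_axial`, `Dprime_lipschitz_kLevel_inv_of_axial` — §2∕§3 AT `u₁⁻¹` for Theorem 4's inductive `u₁` (`InAxZ` + `Restr129Z`).

HONEST SCOPE: the engine's proofs verbatim under the token map; nothing of Bałaban's analysis newly proved; analyticity of `D′` in `λ` NOT here; `HThm4Rec` UNDISCHARGED; caveat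
(C-S3-1) + addendum v4 stand; N05 [B8] DISCHARGED OF RECORD untouched; N05 ∕ N07 NOT discharged; COUNT of record unmoved · K numerically unchanged; one finite `𝕋⁴` programme at
fixed `ε`, Bałaban AS PRINTED; nothing continuum ∕ ℝ⁴ ∕ OS ∕ mass-gap ∕ Clay.  No `sorry`, no `def`.

[cite: Balaban1985RegularSpaces, (1.112)–(1.125) pp.95–97, (1.19) p.79, (1.29) p.81, (1.68)–(1.69) p.88; Balaban1985Averaging, Proposition 10 p.50, (166)–(167) p.44;
Balaban1987RG1, (0.3)–(0.4) pp.252–253]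
-/

noncomputable section

open NormedSpace Finset

namespace Literature.MathematicalPhysics.QuantumFieldTheory.Balaban1983to89.B8SectEKLevelInLambdaRec

open B7Prop1Explicit B7Prop2Explicit B7Prop3Flat B7Prop1Local
open B7Eq170Flat (cj cj_apply)
open B7Prop10General (C6 C4G)
open B7Prop10Flat (one_le_C5 C4'_nonneg C5'_nonneg)
open B7Prop9Flat (C5')
open B7Eq214General (Cgen)
open B8Ineq130 (inBox_of_le)
open B8Ineq130Rec (tlo thi tlo_zero thi_zero)
open B7Eq92Concrete (mgauge)
open B7Eq78Linearization (QprimeIter)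
open B8Eq1117Concrete (XSpace)
open B8Eq1117KLevel (dom120_of_119_tower)
open B8Eq1117KLevelRec (eq1114_of_fixedPoint_kLevel)
open B8SectDSource (fixedPoint_closedBall fixedPoint_mem_of_invariant)
open B8SectEKLevelInLambda (smallness_prod_w)
open B8Eq1122Concrete (cjDiff_sub)
open B8Ineq125Concrete (C2p C2p_nonneg)
open B7Prop2Rec (AvgClosedZ C0Z avgClosedZ_unitaryUnits)
open B7Prop4GeneralLevelsRec (cZ KZ gZ_nonneg)
open B7SectEFLinearisationRec (zdBlockingZ bgTZ InLambdaZ)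
open B8Eq119TwistedAxialRec (InAxZ Restr129Z)
open B8Eq178AveragesRec (QnlZ)
open B8Eq1123ConcreteRec (CnlZ)
open B8SectEInLambdaWitnessRec (norm_CnlZ_le_tower_of_witness lipschitz_CnlZ_tower_of_witness witness_inv_of_axialZ)

-- `Site` alone could resolve to the torus sites of `Setup.lean`; re-export the `ℤ^d` sites of `B7Prop1Explicit`.
export B7Prop1Explicit (Site)

variable {d : ℕ}

/-- The record's gauge-fixing witness constant `20dKZ·c` is non-negative (`KZ = 2(1 + 2g_Z) ≥ 0`). [folklore] -/
private theorem alpha3Z_nonneg (L : ℕ) {c : ℝ} (hc : 0 ≤ c) : 0 ≤ 20 * (d : ℝ) * KZ d L * c := by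
  have hK : 0 ≤ KZ d L := by unfold KZ; have := gZ_nonneg d L; positivity
  positivity

/-! ## §1 «exactly one solution of Eq. (1.117)» at `k` levels, witness form -/

section FixedPoint

variable {𝔸 : Type*} [NormedRing 𝔸] [NormOneClass 𝔸] [NormedAlgebra ℂ 𝔸] [CompleteSpace 𝔸]
variable {L s : ℕ} {G : Subgroup 𝔸ˣ} {U₀ : Site d → Fin d → 𝔸ˣ} {k : ℕ} {Λ : ℕ → Set (Site d)} {H' : XSpace d k 𝔸 →ₗ[ℂ] (Site d → 𝔸)}
  {lam : Site d → 𝔸} {u₁ : Site d → 𝔸ˣ} {α₀ α₃ α₄ B₀' : ℝ}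

/-- The masked transformation (1.118) `X ↦ 𝟙_{𝔅_k}·C′(λ − H′X)` IS A ½-CONTRACTION OF THE BALL `‖X‖ ≤ α₄/(2B′₀)` INTO ITSELF (p. 96–97:
(1.121) self-map + (1.125) contraction), witness form — packaged once for §1's two theorems: there is a map `T` on `XSpace` which on the ball is
pointwise the masked (1.118), maps the ball into itself, and is ½-Lipschitz there.
[cite: Balaban1985RegularSpaces, (1.118)–(1.121) p.96, (1.125) p.97] -/
private theorem contraction_core (hLs : L = 2 * s + 1) (hs1 : 1 ≤ s) (hd : 1 ≤ d) (hL1 : 1 ≤ L) (hG : AvgClosedZ d L G) (hU₀ : ∀ x κ, U₀ x κ ∈ G)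
    (hα : 0 < α₀) (hα3 : C0Z d * α₀ ≤ 1 / 3) (hα4 : 4 * α₀ ≤ c2' d L) (hα₃ : 0 ≤ α₃) (hα₄ : 0 < α₄) (hB : 0 < B₀')
    (h33 : ∀ j, j ≤ k → ∀ y ∈ Λ j, pdevOn (tlo L y j) (thi L y j) U₀ < α₀ * (((L : ℝ) ^ j)⁻¹) ^ 2)
    (hwit : ∀ j, j ≤ k → ∀ y ∈ Λ j, ∃ ut : Site d → 𝔸ˣ,
      InLambdaZ L (clampCfg (tlo L y j) (thi L y j) U₀) ut j α₃ (((L : ℝ) ^ j)⁻¹) ∧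
      ∀ x : Site d, tlo L y j ≤ x → x ≤ thi L y j → u₁ x = ut x)
    (h119b : ∀ j, j ≤ k → ∀ y ∈ Λ j, ∀ x : Site d, InBox (tlo L y j) (thi L y j) x → ‖lam x‖ < α₄ / 2)
    (h119a : ∀ j, j ≤ k → ∀ y ∈ Λ j, ∀ (x : Site d) (κ : Fin d), InBox (tlo L y j) (thi L y j) x →
      InBox (tlo L y j) (thi L y j) (x + e κ) → ‖cj (U₀ x κ) (lam (x + e κ)) - lam x‖ < α₄ / 2 * ((L : ℝ) ^ j)⁻¹)
    (hH0 : ∀ (X : XSpace d k 𝔸) (x : Site d), ‖H' X x‖ ≤ B₀' * ‖X‖)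
    (hH1 : ∀ j, j ≤ k → ∀ y ∈ Λ j, ∀ (X : XSpace d k 𝔸) (x : Site d) (κ : Fin d), InBox (tlo L y j) (thi L y j) x →
      InBox (tlo L y j) (thi L y j) (x + e κ) → ‖cj (U₀ x κ) (H' X (x + e κ)) - H' X x‖ ≤ B₀' * ‖X‖ * ((L : ℝ) ^ j)⁻¹)
    (hα₃' : α₃ ≤ 1 / 200) (hs₁ : 200 * C6 d * (2 * α₄) ≤ 1) (hs₂ : 12000 * ((d : ℝ) + 1) * L * (2 * α₄) ≤ 1)
    (hs₃ : C4G d L * (α₀ + α₃ + 4 * (2 * α₄)) ≤ 1)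
    (hs₄ : 1024 * ((d : ℝ) + 1) * ((d : ℝ) + 4) * L ^ 2 * α₀ ≤ 1) (hs₅ : 32 * ((d : ℝ) + 1) ^ 2 * C6 d * L ^ 2 * α₀ ≤ 1)
    (hs₆ : 16 * d * C5' d * C6 d * (L : ℝ) ^ 2 * α₀ ≤ 1) (hs₇ : 8 * d * C6 d * L * α₀ ≤ 1)
    (hsm : α₃ + α₄ ≤ 1 / (4 * B₀' * (2 * C2p d))) :
    ∃ T : XSpace d k 𝔸 → XSpace d k 𝔸,
      (∀ X : XSpace d k 𝔸, ‖X‖ ≤ α₄ / (2 * B₀') → ∀ p : Fin (k + 1) × Site d,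
        (p.2 ∈ Λ p.1 → T X p = CnlZ L U₀ u₁ p.1 (lam - H' X) p.2) ∧ (p.2 ∉ Λ p.1 → T X p = 0)) ∧
      (∀ X : XSpace d k 𝔸, ‖X‖ ≤ α₄ / (2 * B₀') → ‖T X‖ ≤ α₄ / (2 * B₀')) ∧
      (∀ X Y : XSpace d k 𝔸, ‖X‖ ≤ α₄ / (2 * B₀') → ‖Y‖ ≤ α₄ / (2 * B₀') → ‖T X - T Y‖ ≤ 1 / 2 * ‖X - Y‖) := by
  classical
  have hC2 : 0 ≤ C2p d := C2p_nonneg d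
  have hC2pos : 0 < C2p d := by
    have hC6 : (2 : ℝ) ≤ C6 d := by unfold C6; linarith [one_le_C5 (d := d)]
    unfold C2p Cgen; positivity
  have hρ : 0 ≤ α₄ / (2 * B₀') := by positivity
  -- the (214)/(1.125)-hypotheses at `α₄` follow from those at `2α₄`
  have hC4G : 0 ≤ C4G d L := by
    have h6 : (0 : ℝ) ≤ C6 d := by unfold C6; linarith [one_le_C5 (d := d)]
    have h7 : (0 : ℝ) ≤ B7Prop10General.C7 d := by
      unfold B7Prop10General.C7 C6; linarith [one_le_C5 (d := d), C5'_nonneg (d := d)]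
    have h4' := C4'_nonneg (d := d)
    unfold C4G; positivity
  have hC6 : (0 : ℝ) ≤ C6 d := by unfold C6; linarith [one_le_C5 (d := d)]
  have hs₁' : 200 * C6 d * α₄ ≤ 1 := by
    have h1 : 200 * C6 d * α₄ ≤ 200 * C6 d * (2 * α₄) :=
      mul_le_mul_of_nonneg_left (by linarith only [hα₄]) (by positivity)
    exact h1.trans hs₁
  have hs₂' : 12000 * ((d : ℝ) + 1) * L * α₄ ≤ 1 := by
    have h1 : 12000 * ((d : ℝ) + 1) * L * α₄ ≤ 12000 * ((d : ℝ) + 1) * L * (2 * α₄) :=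
      mul_le_mul_of_nonneg_left (by linarith only [hα₄]) (by positivity)
    exact h1.trans hs₂
  have hs₃' : C4G d L * (α₀ + α₃ + 4 * α₄) ≤ 1 := by
    have h1 : C4G d L * (α₀ + α₃ + 4 * α₄) ≤ C4G d L * (α₀ + α₃ + 4 * (2 * α₄)) :=
      mul_le_mul_of_nonneg_left (by linarith only [hα₄]) hC4G
    exact h1.trans hs₃
  -- print's smallness in product form: `C2p·(α₃ + α₄)·B′₀ ≤ 1/8`
  have hprod : C2p d * (α₃ + α₄) * B₀' ≤ 1 / 8 := by
    have h1 : (α₃ + α₄) * (4 * B₀' * (2 * C2p d)) ≤ 1 := by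
      have := mul_le_mul_of_nonneg_right hsm (by positivity : (0 : ℝ) ≤ 4 * B₀' * (2 * C2p d))
      rwa [one_div, inv_mul_cancel₀ (by positivity)] at this
    have e1 : C2p d * (α₃ + α₄) * B₀' = (α₃ + α₄) * (4 * B₀' * (2 * C2p d)) / 8 := by ring
    rw [e1]
    linarith only [h1]
  have hquarter : C2p d * B₀' * (α₃ + 2 * α₄) ≤ 1 / 4 := by
    have e1 : C2p d * B₀' * (α₃ + 2 * α₄) = 2 * (C2p d * (α₃ + α₄) * B₀') - C2p d * B₀' * α₃ := by ring
    have h0 : 0 ≤ C2p d * B₀' * α₃ := by positivity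
    rw [e1]
    linarith only [hprod, h0]
  -- the masked family of (1.118) and its uniform bound on the ball
  let F : XSpace d k 𝔸 → (Fin (k + 1) × Site d → 𝔸) := fun X p =>
    if p.2 ∈ Λ p.1 then CnlZ L U₀ u₁ p.1 (lam - H' X) p.2 else 0
  -- (1.120) on every tower, for `X` in the ball
  have hdom : ∀ X : XSpace d k 𝔸, ‖X‖ ≤ α₄ / (2 * B₀') → ∀ j, j ≤ k → ∀ y ∈ Λ j,
      (∀ (x : Site d) (κ : Fin d), InBox (tlo L y j) (thi L y j) x → InBox (tlo L y j) (thi L y j) (x + e κ) →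
          ‖cj (U₀ x κ) ((lam - H' X) (x + e κ)) - (lam - H' X) x‖ < α₄ * ((L : ℝ) ^ j)⁻¹) ∧
        ∀ x : Site d, InBox (tlo L y j) (thi L y j) x → ‖(lam - H' X) x‖ < α₄ := fun X hX j hj y hy =>
    dom120_of_119_tower H' hB (by positivity) hH0 (hH1 j hj y hy) (h119a j hj y hy) (h119b j hj y hy) hX
  -- (1.121) at every point of `𝔅_k`, for `X` in the ball (witness form)
  have h121 : ∀ X : XSpace d k 𝔸, ‖X‖ ≤ α₄ / (2 * B₀') → ∀ j, j ≤ k → ∀ y ∈ Λ j,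
      ‖CnlZ L U₀ u₁ j (lam - H' X) y‖ ≤ C2p d * (α₃ + α₄) * α₄ := by
    intro X hX j hj y hy
    obtain ⟨ut, hW, hag⟩ := hwit j hj y hy
    exact norm_CnlZ_le_tower_of_witness hLs hs1 hd hG hU₀ hα hα3 hα4 (h33 j hj y hy) hL1 hW hag hα₄ (hdom X hX j hj y hy).2
      (hdom X hX j hj y hy).1 hα₃ hα₃' hs₁' hs₂' hs₃' hs₄ hs₅ hs₆ hs₇
  have hFbound : ∀ X : XSpace d k 𝔸, ‖X‖ ≤ α₄ / (2 * B₀') → ∀ p : Fin (k + 1) × Site d,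
      ‖F X p‖ ≤ C2p d * (α₃ + α₄) * α₄ := by
    intro X hX p
    simp only [F]
    split_ifs with hp
    · exact h121 X hX p.1 (Nat.le_of_lt_succ p.1.isLt) p.2 hp
    · rw [norm_zero]; positivity
  -- the transformation (1.118) on the `X`-space (packaged where bounded, `0` otherwise — never used there)
  let T : XSpace d k 𝔸 → XSpace d k 𝔸 := fun X =>
    if h : ∃ C : ℝ, ∀ p, ‖F X p‖ ≤ C then BoundedContinuousFunction.ofNormedAddCommGroupDiscrete (F X) h.choose h.choose_spec
    else 0
  have hT_apply : ∀ X : XSpace d k 𝔸, ‖X‖ ≤ α₄ / (2 * B₀') → ∀ p, T X p = F X p := by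
    intro X hX p
    have h : ∃ C : ℝ, ∀ p, ‖F X p‖ ≤ C := ⟨_, hFbound X hX⟩
    simp only [T, dif_pos h]
    rfl
  have hle : C2p d * (α₃ + α₄) * α₄ ≤ α₄ / (2 * B₀') := by
    rw [le_div_iff₀ (by positivity)]
    calc C2p d * (α₃ + α₄) * α₄ * (2 * B₀') = 2 * α₄ * (C2p d * (α₃ + α₄) * B₀') := by ring
      _ ≤ 2 * α₄ * (1 / 8) := mul_le_mul_of_nonneg_left hprod (by positivity)
      _ ≤ α₄ := by linarith only [hα₄]
  refine ⟨T, fun X hX p => ?_, fun X hX => ?_, fun X Y hX hY => ?_⟩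
  · -- pointwise description on the ball
    rw [hT_apply X hX p]
    simp only [F]
    constructor
    · intro hp; rw [if_pos hp]
    · intro hp; rw [if_neg hp]
  · -- self-map
    refine (BoundedContinuousFunction.norm_le hρ).2 fun p => ?_
    rw [hT_apply X hX p]
    exact (hFbound X hX p).trans hle
  · -- contraction with constant `½`
    refine (BoundedContinuousFunction.norm_le (by positivity)).2 fun p => ?_
    rw [BoundedContinuousFunction.coe_sub, Pi.sub_apply, hT_apply X hX p, hT_apply Y hY p]
    simp only [F]
    split_ifs with hp
    · have h2 : 2 * α₄ / 2 = α₄ := by ring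
      obtain ⟨hXa, hXb⟩ := hdom X hX p.1 (Nat.le_of_lt_succ p.1.isLt) p.2 hp
      obtain ⟨hYa, hYb⟩ := hdom Y hY p.1 (Nat.le_of_lt_succ p.1.isLt) p.2 hp
      have hdiff : lam - H' X - (lam - H' Y) = H' (Y - X) := by rw [map_sub]; abel
      have hma : ∀ (x : Site d) (κ : Fin d), InBox (tlo L p.2 p.1) (thi L p.2 p.1) x →
          InBox (tlo L p.2 p.1) (thi L p.2 p.1) (x + e κ) →
          ‖cj (U₀ x κ) ((lam - H' X - (lam - H' Y)) (x + e κ)) - (lam - H' X - (lam - H' Y)) x‖ ≤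
            B₀' * ‖X - Y‖ * ((L : ℝ) ^ (p.1 : ℕ))⁻¹ := fun x κ hx hxe => by
        rw [hdiff, norm_sub_rev X Y]; exact hH1 p.1 (Nat.le_of_lt_succ p.1.isLt) p.2 hp (Y - X) x κ hx hxe
      have hmb : ∀ x : Site d, InBox (tlo L p.2 p.1) (thi L p.2 p.1) x → ‖(lam - H' X - (lam - H' Y)) x‖ ≤ B₀' * ‖X - Y‖ :=
        fun x _ => by rw [hdiff, norm_sub_rev X Y]; exact hH0 (Y - X) x
      obtain ⟨ut, hW, hag⟩ := hwit p.1 (Nat.le_of_lt_succ p.1.isLt) p.2 hp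
      have hlip := lipschitz_CnlZ_tower_of_witness hLs hs1 hd hG hU₀ hα hα3 hα4 (h33 p.1 (Nat.le_of_lt_succ p.1.isLt) p.2 hp) hL1 hW hag
        (by positivity : 0 < 2 * α₄) (by positivity : 0 ≤ B₀' * ‖X - Y‖)
        (fun x hx => by rw [h2]; exact hXb x hx) (fun x κ hx hxe => by rw [h2]; exact hXa x κ hx hxe)
        (fun x hx => by rw [h2]; exact hYb x hx) (fun x κ hx hxe => by rw [h2]; exact hYa x κ hx hxe)
        hmb hma hα₃ hα₃' hs₁ hs₂ hs₃ hs₄ hs₅ hs₆ hs₇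
      have hκ : C2p d * (2 * (B₀' * ‖X - Y‖)) * (α₃ + 2 * α₄) ≤ 1 / 2 * ‖X - Y‖ := by
        have hXY := norm_nonneg (X - Y)
        calc C2p d * (2 * (B₀' * ‖X - Y‖)) * (α₃ + 2 * α₄)
            = 2 * ‖X - Y‖ * (C2p d * B₀' * (α₃ + 2 * α₄)) := by ring
          _ ≤ 2 * ‖X - Y‖ * (1 / 4) := mul_le_mul_of_nonneg_left hquarter (by positivity)
          _ = 1 / 2 * ‖X - Y‖ := by ring
      exact hlip.trans hκ
    · rw [sub_self, norm_zero]; positivity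

omit [NormOneClass 𝔸] in
/-- Reading a map that is pointwise the masked (1.118) on the ball: `T X = X` iff `X` solves (1.117) on `𝔅_k` and vanishes off `𝔅_k`.
[cite: Balaban1985RegularSpaces, (1.117)–(1.118) p.96] -/
private theorem fixed_iff_pointwise {T : XSpace d k 𝔸 → XSpace d k 𝔸} {X : XSpace d k 𝔸}
    (hT : ∀ p : Fin (k + 1) × Site d,
      (p.2 ∈ Λ p.1 → T X p = CnlZ L U₀ u₁ p.1 (lam - H' X) p.2) ∧ (p.2 ∉ Λ p.1 → T X p = 0)) :
    T X = X ↔ ∀ (j : ℕ) (hj : j ≤ k) (y : Site d),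
      (y ∈ Λ j → X (⟨j, Nat.lt_succ_of_le hj⟩, y) = CnlZ L U₀ u₁ j (lam - H' X) y) ∧
        (y ∉ Λ j → X (⟨j, Nat.lt_succ_of_le hj⟩, y) = 0) := by
  constructor
  · intro hTX j hj y
    have h : T X (⟨j, Nat.lt_succ_of_le hj⟩, y) = X (⟨j, Nat.lt_succ_of_le hj⟩, y) :=
      congrArg (fun Z : XSpace d k 𝔸 => Z (⟨j, Nat.lt_succ_of_le hj⟩, y)) hTX
    obtain ⟨h1, h2⟩ := hT (⟨j, Nat.lt_succ_of_le hj⟩, y)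
    constructor
    · intro hy; rw [← h, h1 hy]
    · intro hy; rw [← h, h2 hy]
  · intro hP
    apply BoundedContinuousFunction.ext
    intro p
    obtain ⟨h1, h2⟩ := hP p.1 (Nat.le_of_lt_succ p.1.isLt) p.2
    have hp : (⟨(p.1 : ℕ), Nat.lt_succ_of_le (Nat.le_of_lt_succ p.1.isLt)⟩ : Fin (k + 1)) = p.1 := Fin.ext rfl
    rw [hp] at h1 h2
    obtain ⟨t1, t2⟩ := hT p
    by_cases hy : p.2 ∈ Λ p.1
    · rw [t1 hy, h1 hy]
    · rw [t2 hy, h2 hy]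

/-- **«BY THE CONTRACTION MAPPING THEOREM THERE EXISTS EXACTLY ONE SOLUTION OF Eq. (1.117)» AT `k` LEVELS, WITNESS FORM, record structure** (p. 97): dag-n05-b's
`B8Eq1117KLevel.eq1117_existsUnique_kLevel` with the hypothesis «`u₁ = glev_j` on `Bʲ(y)`» (and the (1.69)/[3]-Props-8–9 inputs that served only
to put that gauge fixing in `Λ_j`) REPLACED by a `Λ_j`-WITNESS for `u₁` at every `(j, y ∈ Λ_j)` («`u₁ ∈ Λ_k(U₀, α₃)`», the hypothesis of
Proposition 10 of [3] as printed); `α₃` free.  There is EXACTLY ONE `X ∈ XSpace d k 𝔸` with `‖X‖ ≤ α₄/(2B′₀)` such that `X(j, y) = C′_j(u₁, λ − H′X)(y)`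
for `y ∈ Λ_j` and `X(j, y) = 0` for `y ∉ Λ_j` (`j ≤ k`).
[cite: Balaban1985RegularSpaces, (1.117)–(1.121) pp.96–97, p.97 (contraction, exactly one solution); Balaban1985Averaging, Prop. 10 p.50] -/
theorem eq1117_existsUnique_kLevel_w (hLs : L = 2 * s + 1) (hs1 : 1 ≤ s) (hd : 1 ≤ d) (hL1 : 1 ≤ L) (hG : AvgClosedZ d L G) (hU₀ : ∀ x κ, U₀ x κ ∈ G)
    (hα : 0 < α₀) (hα3 : C0Z d * α₀ ≤ 1 / 3) (hα4 : 4 * α₀ ≤ c2' d L) (hα₃ : 0 ≤ α₃) (hα₄ : 0 < α₄) (hB : 0 < B₀')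
    (h33 : ∀ j, j ≤ k → ∀ y ∈ Λ j, pdevOn (tlo L y j) (thi L y j) U₀ < α₀ * (((L : ℝ) ^ j)⁻¹) ^ 2)
    (hwit : ∀ j, j ≤ k → ∀ y ∈ Λ j, ∃ ut : Site d → 𝔸ˣ,
      InLambdaZ L (clampCfg (tlo L y j) (thi L y j) U₀) ut j α₃ (((L : ℝ) ^ j)⁻¹) ∧
      ∀ x : Site d, tlo L y j ≤ x → x ≤ thi L y j → u₁ x = ut x)
    (h119b : ∀ j, j ≤ k → ∀ y ∈ Λ j, ∀ x : Site d, InBox (tlo L y j) (thi L y j) x → ‖lam x‖ < α₄ / 2)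
    (h119a : ∀ j, j ≤ k → ∀ y ∈ Λ j, ∀ (x : Site d) (κ : Fin d), InBox (tlo L y j) (thi L y j) x →
      InBox (tlo L y j) (thi L y j) (x + e κ) → ‖cj (U₀ x κ) (lam (x + e κ)) - lam x‖ < α₄ / 2 * ((L : ℝ) ^ j)⁻¹)
    (hH0 : ∀ (X : XSpace d k 𝔸) (x : Site d), ‖H' X x‖ ≤ B₀' * ‖X‖)
    (hH1 : ∀ j, j ≤ k → ∀ y ∈ Λ j, ∀ (X : XSpace d k 𝔸) (x : Site d) (κ : Fin d), InBox (tlo L y j) (thi L y j) x →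
      InBox (tlo L y j) (thi L y j) (x + e κ) → ‖cj (U₀ x κ) (H' X (x + e κ)) - H' X x‖ ≤ B₀' * ‖X‖ * ((L : ℝ) ^ j)⁻¹)
    (hα₃' : α₃ ≤ 1 / 200) (hs₁ : 200 * C6 d * (2 * α₄) ≤ 1) (hs₂ : 12000 * ((d : ℝ) + 1) * L * (2 * α₄) ≤ 1)
    (hs₃ : C4G d L * (α₀ + α₃ + 4 * (2 * α₄)) ≤ 1)
    (hs₄ : 1024 * ((d : ℝ) + 1) * ((d : ℝ) + 4) * L ^ 2 * α₀ ≤ 1) (hs₅ : 32 * ((d : ℝ) + 1) ^ 2 * C6 d * L ^ 2 * α₀ ≤ 1)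
    (hs₆ : 16 * d * C5' d * C6 d * (L : ℝ) ^ 2 * α₀ ≤ 1) (hs₇ : 8 * d * C6 d * L * α₀ ≤ 1)
    (hsm : α₃ + α₄ ≤ 1 / (4 * B₀' * (2 * C2p d))) :
    ∃! X : XSpace d k 𝔸, ‖X‖ ≤ α₄ / (2 * B₀') ∧
      ∀ (j : ℕ) (hj : j ≤ k) (y : Site d),
        (y ∈ Λ j → X (⟨j, Nat.lt_succ_of_le hj⟩, y) = CnlZ L U₀ u₁ j (lam - H' X) y) ∧
          (y ∉ Λ j → X (⟨j, Nat.lt_succ_of_le hj⟩, y) = 0) := by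
  obtain ⟨T, hT, hmaps, hlip⟩ := contraction_core hLs hs1 hd hL1 hG hU₀ hα hα3 hα4 hα₃ hα₄ hB h33 hwit h119b h119a hH0 hH1 hα₃' hs₁ hs₂ hs₃
    hs₄ hs₅ hs₆ hs₇ hsm
  have hρ : 0 ≤ α₄ / (2 * B₀') := by positivity
  obtain ⟨X, ⟨hXρ, hXfix⟩, huniq⟩ := fixedPoint_closedBall T hρ (κ := 1 / 2) (by norm_num) (by norm_num) hmaps hlip
  refine ⟨X, ⟨hXρ, (fixed_iff_pointwise (hT X hXρ)).1 hXfix⟩, fun Y hY => huniq Y ⟨hY.1, (fixed_iff_pointwise (hT Y hY.1)).2 hY.2⟩⟩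

/-- **THE SOLUTION OF (1.117) LIES IN EVERY CLOSED SET `S ∋ 0` INVARIANT UNDER THE MASKED (1.118) ON THE BALL** (r05's device for the reality of
fixed points, `B8SectDSource.fixedPoint_mem_of_invariant`, p. 93 «λ … with values in the complexified algebra»; here for `X`, e.g. `S` = the
skew-adjoint configurations): if `S ⊂ XSpace d k 𝔸` is closed, contains `0`, and for every `X ∈ S` in the ball every configuration `Y`
that is `C′(u₁, λ − H′X)` on `𝔅_k` and `0` off `𝔅_k` again lies in `S`, then any `X` in the ball solving (1.117) on `𝔅_k` and vanishing off
`𝔅_k` lies in `S`.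
[cite: Balaban1985RegularSpaces, (1.117)–(1.118) p.96, p.97, p.93 (real solutions)] -/
theorem eq1117_solution_mem_of_invariant_w (hLs : L = 2 * s + 1) (hs1 : 1 ≤ s) (hd : 1 ≤ d) (hL1 : 1 ≤ L) (hG : AvgClosedZ d L G) (hU₀ : ∀ x κ, U₀ x κ ∈ G)
    (hα : 0 < α₀) (hα3 : C0Z d * α₀ ≤ 1 / 3) (hα4 : 4 * α₀ ≤ c2' d L) (hα₃ : 0 ≤ α₃) (hα₄ : 0 < α₄) (hB : 0 < B₀')
    (h33 : ∀ j, j ≤ k → ∀ y ∈ Λ j, pdevOn (tlo L y j) (thi L y j) U₀ < α₀ * (((L : ℝ) ^ j)⁻¹) ^ 2)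
    (hwit : ∀ j, j ≤ k → ∀ y ∈ Λ j, ∃ ut : Site d → 𝔸ˣ,
      InLambdaZ L (clampCfg (tlo L y j) (thi L y j) U₀) ut j α₃ (((L : ℝ) ^ j)⁻¹) ∧
      ∀ x : Site d, tlo L y j ≤ x → x ≤ thi L y j → u₁ x = ut x)
    (h119b : ∀ j, j ≤ k → ∀ y ∈ Λ j, ∀ x : Site d, InBox (tlo L y j) (thi L y j) x → ‖lam x‖ < α₄ / 2)
    (h119a : ∀ j, j ≤ k → ∀ y ∈ Λ j, ∀ (x : Site d) (κ : Fin d), InBox (tlo L y j) (thi L y j) x →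
      InBox (tlo L y j) (thi L y j) (x + e κ) → ‖cj (U₀ x κ) (lam (x + e κ)) - lam x‖ < α₄ / 2 * ((L : ℝ) ^ j)⁻¹)
    (hH0 : ∀ (X : XSpace d k 𝔸) (x : Site d), ‖H' X x‖ ≤ B₀' * ‖X‖)
    (hH1 : ∀ j, j ≤ k → ∀ y ∈ Λ j, ∀ (X : XSpace d k 𝔸) (x : Site d) (κ : Fin d), InBox (tlo L y j) (thi L y j) x →
      InBox (tlo L y j) (thi L y j) (x + e κ) → ‖cj (U₀ x κ) (H' X (x + e κ)) - H' X x‖ ≤ B₀' * ‖X‖ * ((L : ℝ) ^ j)⁻¹)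
    (hα₃' : α₃ ≤ 1 / 200) (hs₁ : 200 * C6 d * (2 * α₄) ≤ 1) (hs₂ : 12000 * ((d : ℝ) + 1) * L * (2 * α₄) ≤ 1)
    (hs₃ : C4G d L * (α₀ + α₃ + 4 * (2 * α₄)) ≤ 1)
    (hs₄ : 1024 * ((d : ℝ) + 1) * ((d : ℝ) + 4) * L ^ 2 * α₀ ≤ 1) (hs₅ : 32 * ((d : ℝ) + 1) ^ 2 * C6 d * L ^ 2 * α₀ ≤ 1)
    (hs₆ : 16 * d * C5' d * C6 d * (L : ℝ) ^ 2 * α₀ ≤ 1) (hs₇ : 8 * d * C6 d * L * α₀ ≤ 1)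
    (hsm : α₃ + α₄ ≤ 1 / (4 * B₀' * (2 * C2p d)))
    (S : Set (XSpace d k 𝔸)) (hS : IsClosed S) (h0 : (0 : XSpace d k 𝔸) ∈ S)
    (hinv : ∀ X ∈ S, ‖X‖ ≤ α₄ / (2 * B₀') → ∀ Y : XSpace d k 𝔸,
      (∀ p : Fin (k + 1) × Site d, (p.2 ∈ Λ p.1 → Y p = CnlZ L U₀ u₁ p.1 (lam - H' X) p.2) ∧ (p.2 ∉ Λ p.1 → Y p = 0)) →
      Y ∈ S)
    {X : XSpace d k 𝔸} (hXρ : ‖X‖ ≤ α₄ / (2 * B₀'))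
    (hzero : ∀ (j : ℕ) (hj : j ≤ k) (y : Site d), y ∉ Λ j → X (⟨j, Nat.lt_succ_of_le hj⟩, y) = 0)
    (hfix : ∀ (j : ℕ) (hj : j ≤ k) (y : Site d), y ∈ Λ j → CnlZ L U₀ u₁ j (lam - H' X) y = X (⟨j, Nat.lt_succ_of_le hj⟩, y)) :
    X ∈ S := by
  obtain ⟨T, hT, hmaps, hlip⟩ := contraction_core hLs hs1 hd hL1 hG hU₀ hα hα3 hα4 hα₃ hα₄ hB h33 hwit h119b h119a hH0 hH1 hα₃' hs₁ hs₂ hs₃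
    hs₄ hs₅ hs₆ hs₇ hsm
  have hρ : 0 ≤ α₄ / (2 * B₀') := by positivity
  have hTX : T X = X :=
    (fixed_iff_pointwise (hT X hXρ)).2 fun j hj y => ⟨fun hy => (hfix j hj y hy).symm, fun hy => hzero j hj y hy⟩
  exact fixedPoint_mem_of_invariant T hρ (κ := 1 / 2) (by norm_num) (by norm_num) hmaps hlip S hS h0
    (fun Y hY hYρ => hinv Y hY hYρ (T Y) (hT Y hYρ)) hXρ hTX

end FixedPoint

/-! ## §2 `D′(λ)` and (1.114) on `𝔅_k`, witness form -/

section Dprime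

variable {𝔸 : Type*} [NormedRing 𝔸] [NormOneClass 𝔸] [NormedAlgebra ℂ 𝔸] [CompleteSpace 𝔸]
variable {L s : ℕ} {G : Subgroup 𝔸ˣ} {U₀ : Site d → Fin d → 𝔸ˣ} {k : ℕ} {Λ : ℕ → Set (Site d)} {H' : XSpace d k 𝔸 →ₗ[ℂ] (Site d → 𝔸)}
  {lam : Site d → 𝔸} {u₁ : Site d → 𝔸ˣ} {α₀ α₃ α₄ B₀' : ℝ}

/-- **«|D′(λ)| = |C′(λ − H′D′(λ))| < C′₂(α₃ + α₄)α₄»** (p. 97) AT `k` LEVELS, WITNESS FORM (dag-n05-b's `norm_Dprime_le_kLevel` with the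
`Λ_j`-witness): any `X` in the ball solving (1.117) on `𝔅_k` and vanishing off `𝔅_k` has `‖X‖ ≤ C2p·(α₃ + α₄)·α₄` (windows at `α₄`).
[cite: Balaban1985RegularSpaces, p.97, (1.116) p.96, (1.121) p.96] -/
theorem norm_Dprime_le_kLevel_w (hLs : L = 2 * s + 1) (hs1 : 1 ≤ s) (hd : 1 ≤ d) (hL1 : 1 ≤ L) (hG : AvgClosedZ d L G) (hU₀ : ∀ x κ, U₀ x κ ∈ G)
    (hα : 0 < α₀) (hα3 : C0Z d * α₀ ≤ 1 / 3) (hα4 : 4 * α₀ ≤ c2' d L) (hα₃ : 0 ≤ α₃) (hα₄ : 0 < α₄) (hB : 0 < B₀')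
    (h33 : ∀ j, j ≤ k → ∀ y ∈ Λ j, pdevOn (tlo L y j) (thi L y j) U₀ < α₀ * (((L : ℝ) ^ j)⁻¹) ^ 2)
    (hwit : ∀ j, j ≤ k → ∀ y ∈ Λ j, ∃ ut : Site d → 𝔸ˣ,
      InLambdaZ L (clampCfg (tlo L y j) (thi L y j) U₀) ut j α₃ (((L : ℝ) ^ j)⁻¹) ∧
      ∀ x : Site d, tlo L y j ≤ x → x ≤ thi L y j → u₁ x = ut x)
    (h119b : ∀ j, j ≤ k → ∀ y ∈ Λ j, ∀ x : Site d, InBox (tlo L y j) (thi L y j) x → ‖lam x‖ < α₄ / 2)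
    (h119a : ∀ j, j ≤ k → ∀ y ∈ Λ j, ∀ (x : Site d) (κ : Fin d), InBox (tlo L y j) (thi L y j) x →
      InBox (tlo L y j) (thi L y j) (x + e κ) → ‖cj (U₀ x κ) (lam (x + e κ)) - lam x‖ < α₄ / 2 * ((L : ℝ) ^ j)⁻¹)
    (hH0 : ∀ (X : XSpace d k 𝔸) (x : Site d), ‖H' X x‖ ≤ B₀' * ‖X‖)
    (hH1 : ∀ j, j ≤ k → ∀ y ∈ Λ j, ∀ (X : XSpace d k 𝔸) (x : Site d) (κ : Fin d), InBox (tlo L y j) (thi L y j) x →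
      InBox (tlo L y j) (thi L y j) (x + e κ) → ‖cj (U₀ x κ) (H' X (x + e κ)) - H' X x‖ ≤ B₀' * ‖X‖ * ((L : ℝ) ^ j)⁻¹)
    (hα₃' : α₃ ≤ 1 / 200) (hs₁ : 200 * C6 d * α₄ ≤ 1) (hs₂ : 12000 * ((d : ℝ) + 1) * L * α₄ ≤ 1)
    (hs₃ : C4G d L * (α₀ + α₃ + 4 * α₄) ≤ 1)
    (hs₄ : 1024 * ((d : ℝ) + 1) * ((d : ℝ) + 4) * L ^ 2 * α₀ ≤ 1) (hs₅ : 32 * ((d : ℝ) + 1) ^ 2 * C6 d * L ^ 2 * α₀ ≤ 1)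
    (hs₆ : 16 * d * C5' d * C6 d * (L : ℝ) ^ 2 * α₀ ≤ 1) (hs₇ : 8 * d * C6 d * L * α₀ ≤ 1)
    {X : XSpace d k 𝔸} (hXρ : ‖X‖ ≤ α₄ / (2 * B₀'))
    (hzero : ∀ (j : ℕ) (hj : j ≤ k) (y : Site d), y ∉ Λ j → X (⟨j, Nat.lt_succ_of_le hj⟩, y) = 0)
    (hfix : ∀ (j : ℕ) (hj : j ≤ k) (y : Site d), y ∈ Λ j → CnlZ L U₀ u₁ j (lam - H' X) y = X (⟨j, Nat.lt_succ_of_le hj⟩, y)) :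
    ‖X‖ ≤ C2p d * (α₃ + α₄) * α₄ := by
  have hC2 : 0 ≤ C2p d := C2p_nonneg d
  refine (BoundedContinuousFunction.norm_le (by positivity)).2 fun p => ?_
  have hp : ((⟨(p.1 : ℕ), Nat.lt_succ_of_le (Nat.le_of_lt_succ p.1.isLt)⟩ : Fin (k + 1)), p.2) = p :=
    Prod.ext (Fin.ext rfl) rfl
  by_cases hy : p.2 ∈ Λ p.1
  · obtain ⟨ha, hb⟩ := dom120_of_119_tower H' hB (by positivity) hH0 (hH1 p.1 (Nat.le_of_lt_succ p.1.isLt) p.2 hy)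
      (h119a p.1 (Nat.le_of_lt_succ p.1.isLt) p.2 hy) (h119b p.1 (Nat.le_of_lt_succ p.1.isLt) p.2 hy) hXρ
    have h := hfix p.1 (Nat.le_of_lt_succ p.1.isLt) p.2 hy
    rw [hp] at h
    rw [← h]
    obtain ⟨ut, hW, hag⟩ := hwit p.1 (Nat.le_of_lt_succ p.1.isLt) p.2 hy
    exact norm_CnlZ_le_tower_of_witness hLs hs1 hd hG hU₀ hα hα3 hα4 (h33 p.1 (Nat.le_of_lt_succ p.1.isLt) p.2 hy) hL1 hW hag hα₄ hb ha
      hα₃ hα₃' hs₁ hs₂ hs₃ hs₄ hs₅ hs₆ hs₇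
  · have h := hzero p.1 (Nat.le_of_lt_succ p.1.isLt) p.2 hy
    rw [hp] at h
    rw [h, norm_zero]
    positivity

/-- **«WE TAKE D′(λ) EQUAL TO THIS SOLUTION» + (1.114) AT `k` LEVELS, WITNESS FORM, record structure** (dag-n05-b's `exists_Dprime_kLevel` with the
`Λ_j`-witness): there is `X = D′(λ)` with `‖X‖ ≤ α₄/(2B′₀)`, `‖X‖ ≤ C2p(α₃ + α₄)α₄`, vanishing off `𝔅_k`, solving (1.117) on `𝔅_k`, and with
(1.114) `Q′_j(u₁, λ − H′X)(y) = (Q′_jλ)(y)` on `𝔅_k` (given `Q′H′ = I` there, (1.91)).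
[cite: Balaban1985RegularSpaces, (1.113)–(1.114) p.95, (1.117) p.96, p.97] -/
theorem exists_Dprime_kLevel_w (hLs : L = 2 * s + 1) (hs1 : 1 ≤ s) (hd : 1 ≤ d) (hL1 : 1 ≤ L) (hG : AvgClosedZ d L G) (hU₀ : ∀ x κ, U₀ x κ ∈ G)
    (hα : 0 < α₀) (hα3 : C0Z d * α₀ ≤ 1 / 3) (hα4 : 4 * α₀ ≤ c2' d L) (hα₃ : 0 ≤ α₃) (hα₄ : 0 < α₄) (hB : 0 < B₀')
    (h33 : ∀ j, j ≤ k → ∀ y ∈ Λ j, pdevOn (tlo L y j) (thi L y j) U₀ < α₀ * (((L : ℝ) ^ j)⁻¹) ^ 2)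
    (hwit : ∀ j, j ≤ k → ∀ y ∈ Λ j, ∃ ut : Site d → 𝔸ˣ,
      InLambdaZ L (clampCfg (tlo L y j) (thi L y j) U₀) ut j α₃ (((L : ℝ) ^ j)⁻¹) ∧
      ∀ x : Site d, tlo L y j ≤ x → x ≤ thi L y j → u₁ x = ut x)
    (h119b : ∀ j, j ≤ k → ∀ y ∈ Λ j, ∀ x : Site d, InBox (tlo L y j) (thi L y j) x → ‖lam x‖ < α₄ / 2)
    (h119a : ∀ j, j ≤ k → ∀ y ∈ Λ j, ∀ (x : Site d) (κ : Fin d), InBox (tlo L y j) (thi L y j) x →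
      InBox (tlo L y j) (thi L y j) (x + e κ) → ‖cj (U₀ x κ) (lam (x + e κ)) - lam x‖ < α₄ / 2 * ((L : ℝ) ^ j)⁻¹)
    (hH0 : ∀ (X : XSpace d k 𝔸) (x : Site d), ‖H' X x‖ ≤ B₀' * ‖X‖)
    (hH1 : ∀ j, j ≤ k → ∀ y ∈ Λ j, ∀ (X : XSpace d k 𝔸) (x : Site d) (κ : Fin d), InBox (tlo L y j) (thi L y j) x →
      InBox (tlo L y j) (thi L y j) (x + e κ) → ‖cj (U₀ x κ) (H' X (x + e κ)) - H' X x‖ ≤ B₀' * ‖X‖ * ((L : ℝ) ^ j)⁻¹)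
    (hQH : ∀ (Y : XSpace d k 𝔸) (j : ℕ) (hj : j ≤ k) (y : Site d), y ∈ Λ j →
      QprimeIter (zdBlockingZ d L) (bgTZ L U₀) j (H' Y) y = Y (⟨j, Nat.lt_succ_of_le hj⟩, y))
    (hα₃' : α₃ ≤ 1 / 200) (hs₁ : 200 * C6 d * (2 * α₄) ≤ 1) (hs₂ : 12000 * ((d : ℝ) + 1) * L * (2 * α₄) ≤ 1)
    (hs₃ : C4G d L * (α₀ + α₃ + 4 * (2 * α₄)) ≤ 1)
    (hs₄ : 1024 * ((d : ℝ) + 1) * ((d : ℝ) + 4) * L ^ 2 * α₀ ≤ 1) (hs₅ : 32 * ((d : ℝ) + 1) ^ 2 * C6 d * L ^ 2 * α₀ ≤ 1)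
    (hs₆ : 16 * d * C5' d * C6 d * (L : ℝ) ^ 2 * α₀ ≤ 1) (hs₇ : 8 * d * C6 d * L * α₀ ≤ 1)
    (hsm : α₃ + α₄ ≤ 1 / (4 * B₀' * (2 * C2p d))) :
    ∃ X : XSpace d k 𝔸, ‖X‖ ≤ α₄ / (2 * B₀') ∧ ‖X‖ ≤ C2p d * (α₃ + α₄) * α₄ ∧
      (∀ (j : ℕ) (hj : j ≤ k) (y : Site d), y ∉ Λ j → X (⟨j, Nat.lt_succ_of_le hj⟩, y) = 0) ∧
      (∀ (j : ℕ) (hj : j ≤ k) (y : Site d), y ∈ Λ j →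
        CnlZ L U₀ u₁ j (lam - H' X) y = X (⟨j, Nat.lt_succ_of_le hj⟩, y)) ∧
      ∀ (j : ℕ), j ≤ k → ∀ y ∈ Λ j,
        QnlZ L U₀ (fun x => expUnit ((lam - H' X) x)) u₁ j y = QprimeIter (zdBlockingZ d L) (bgTZ L U₀) j lam y := by
  obtain ⟨X, ⟨hXρ, hXfix⟩, -⟩ := eq1117_existsUnique_kLevel_w hLs hs1 hd hL1 hG hU₀ hα hα3 hα4 hα₃ hα₄ hB h33 hwit h119b h119a hH0 hH1 hα₃'
    hs₁ hs₂ hs₃ hs₄ hs₅ hs₆ hs₇ hsm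
  have hfix : ∀ (j : ℕ) (hj : j ≤ k) (y : Site d), y ∈ Λ j → CnlZ L U₀ u₁ j (lam - H' X) y = X (⟨j, Nat.lt_succ_of_le hj⟩, y) :=
    fun j hj y hy => ((hXfix j hj y).1 hy).symm
  have hzero : ∀ (j : ℕ) (hj : j ≤ k) (y : Site d), y ∉ Λ j → X (⟨j, Nat.lt_succ_of_le hj⟩, y) = 0 :=
    fun j hj y hy => (hXfix j hj y).2 hy
  -- the smallness at `α₄` from the one at `2α₄`
  have hC6 : (0 : ℝ) ≤ C6 d := by unfold C6; linarith [one_le_C5 (d := d)]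
  have hC4G : 0 ≤ C4G d L := by
    have h7 : (0 : ℝ) ≤ B7Prop10General.C7 d := by
      unfold B7Prop10General.C7 C6; linarith [one_le_C5 (d := d), C5'_nonneg (d := d)]
    have h4' := C4'_nonneg (d := d)
    unfold C4G; positivity
  have hs₁' : 200 * C6 d * α₄ ≤ 1 :=
    (mul_le_mul_of_nonneg_left (by linarith only [hα₄]) (by positivity)).trans hs₁
  have hs₂' : 12000 * ((d : ℝ) + 1) * L * α₄ ≤ 1 :=
    (mul_le_mul_of_nonneg_left (by linarith only [hα₄]) (by positivity)).trans hs₂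
  have hs₃' : C4G d L * (α₀ + α₃ + 4 * α₄) ≤ 1 :=
    (mul_le_mul_of_nonneg_left (by linarith only [hα₄]) hC4G).trans hs₃
  have hbd := norm_Dprime_le_kLevel_w hLs hs1 hd hL1 hG hU₀ hα hα3 hα4 hα₃ hα₄ hB h33 hwit h119b h119a hH0 hH1 hα₃' hs₁' hs₂' hs₃' hs₄ hs₅
    hs₆ hs₇ hXρ hzero hfix
  exact ⟨X, hXρ, hbd, hzero, hfix, eq1114_of_fixedPoint_kLevel Λ H' hQH hfix⟩

end Dprime

/-! ## §3 `D′` is Lipschitz in `λ`, witness form -/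

section Lip

variable {𝔸 : Type*} [NormedRing 𝔸] [NormOneClass 𝔸] [NormedAlgebra ℂ 𝔸] [CompleteSpace 𝔸]
variable {L s : ℕ} {G : Subgroup 𝔸ˣ} {U₀ : Site d → Fin d → 𝔸ˣ} {k : ℕ} {Λ : ℕ → Set (Site d)} {H' : XSpace d k 𝔸 →ₗ[ℂ] (Site d → 𝔸)}
  {lam₁ lam₂ : Site d → 𝔸} {u₁ : Site d → 𝔸ˣ} {α₀ α₃ α₄ B₀' m : ℝ}

/-- **THE KEY INEQUALITY FOR `D′(λ₁) − D′(λ₂)` AT `k` LEVELS, WITNESS FORM, record structure** (dag-n05-b's `Dprime_diff_le_kLevel` with the `Λ_j`-witness):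
`‖X₁ − X₂‖ ≤ c·m + c·B′₀·‖X₁ − X₂‖`, `c = 2C2p(α₃ + 2α₄)`, for `λ₁, λ₂` in the half-size set (1.119) on every tower with difference modulus `m`, and
`X₁, X₂` in the ball solving (1.117) on `𝔅_k` for `λ₁, λ₂` and vanishing off `𝔅_k`.
[cite: Balaban1985RegularSpaces, p.97 (after (1.125)), (1.117)–(1.122) p.96, (1.125) p.97] -/
theorem Dprime_diff_le_kLevel_w (hLs : L = 2 * s + 1) (hs1 : 1 ≤ s) (hd : 1 ≤ d) (hL1 : 1 ≤ L) (hG : AvgClosedZ d L G) (hU₀ : ∀ x κ, U₀ x κ ∈ G)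
    (hα : 0 < α₀) (hα3 : C0Z d * α₀ ≤ 1 / 3) (hα4 : 4 * α₀ ≤ c2' d L) (hα₃ : 0 ≤ α₃) (hα₄ : 0 < α₄) (hB : 0 < B₀') (hm : 0 ≤ m)
    (h33 : ∀ j, j ≤ k → ∀ y ∈ Λ j, pdevOn (tlo L y j) (thi L y j) U₀ < α₀ * (((L : ℝ) ^ j)⁻¹) ^ 2)
    (hwit : ∀ j, j ≤ k → ∀ y ∈ Λ j, ∃ ut : Site d → 𝔸ˣ,
      InLambdaZ L (clampCfg (tlo L y j) (thi L y j) U₀) ut j α₃ (((L : ℝ) ^ j)⁻¹) ∧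
      ∀ x : Site d, tlo L y j ≤ x → x ≤ thi L y j → u₁ x = ut x)
    (h₁b : ∀ j, j ≤ k → ∀ y ∈ Λ j, ∀ x : Site d, InBox (tlo L y j) (thi L y j) x → ‖lam₁ x‖ < α₄ / 2)
    (h₁a : ∀ j, j ≤ k → ∀ y ∈ Λ j, ∀ (x : Site d) (κ : Fin d), InBox (tlo L y j) (thi L y j) x →
      InBox (tlo L y j) (thi L y j) (x + e κ) → ‖cj (U₀ x κ) (lam₁ (x + e κ)) - lam₁ x‖ < α₄ / 2 * ((L : ℝ) ^ j)⁻¹)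
    (h₂b : ∀ j, j ≤ k → ∀ y ∈ Λ j, ∀ x : Site d, InBox (tlo L y j) (thi L y j) x → ‖lam₂ x‖ < α₄ / 2)
    (h₂a : ∀ j, j ≤ k → ∀ y ∈ Λ j, ∀ (x : Site d) (κ : Fin d), InBox (tlo L y j) (thi L y j) x →
      InBox (tlo L y j) (thi L y j) (x + e κ) → ‖cj (U₀ x κ) (lam₂ (x + e κ)) - lam₂ x‖ < α₄ / 2 * ((L : ℝ) ^ j)⁻¹)
    (hmb : ∀ j, j ≤ k → ∀ y ∈ Λ j, ∀ x : Site d, InBox (tlo L y j) (thi L y j) x → ‖(lam₁ - lam₂) x‖ ≤ m)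
    (hma : ∀ j, j ≤ k → ∀ y ∈ Λ j, ∀ (x : Site d) (κ : Fin d), InBox (tlo L y j) (thi L y j) x →
      InBox (tlo L y j) (thi L y j) (x + e κ) → ‖cj (U₀ x κ) ((lam₁ - lam₂) (x + e κ)) - (lam₁ - lam₂) x‖ ≤ m * ((L : ℝ) ^ j)⁻¹)
    (hH0 : ∀ (X : XSpace d k 𝔸) (x : Site d), ‖H' X x‖ ≤ B₀' * ‖X‖)
    (hH1 : ∀ j, j ≤ k → ∀ y ∈ Λ j, ∀ (X : XSpace d k 𝔸) (x : Site d) (κ : Fin d), InBox (tlo L y j) (thi L y j) x →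
      InBox (tlo L y j) (thi L y j) (x + e κ) → ‖cj (U₀ x κ) (H' X (x + e κ)) - H' X x‖ ≤ B₀' * ‖X‖ * ((L : ℝ) ^ j)⁻¹)
    (hα₃' : α₃ ≤ 1 / 200) (hs₁ : 200 * C6 d * (2 * α₄) ≤ 1) (hs₂ : 12000 * ((d : ℝ) + 1) * L * (2 * α₄) ≤ 1)
    (hs₃ : C4G d L * (α₀ + α₃ + 4 * (2 * α₄)) ≤ 1)
    (hs₄ : 1024 * ((d : ℝ) + 1) * ((d : ℝ) + 4) * L ^ 2 * α₀ ≤ 1) (hs₅ : 32 * ((d : ℝ) + 1) ^ 2 * C6 d * L ^ 2 * α₀ ≤ 1)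
    (hs₆ : 16 * d * C5' d * C6 d * (L : ℝ) ^ 2 * α₀ ≤ 1) (hs₇ : 8 * d * C6 d * L * α₀ ≤ 1)
    {X₁ X₂ : XSpace d k 𝔸} (hX₁ : ‖X₁‖ ≤ α₄ / (2 * B₀')) (hX₂ : ‖X₂‖ ≤ α₄ / (2 * B₀'))
    (hzero₁ : ∀ (j : ℕ) (hj : j ≤ k) (y : Site d), y ∉ Λ j → X₁ (⟨j, Nat.lt_succ_of_le hj⟩, y) = 0)
    (hfix₁ : ∀ (j : ℕ) (hj : j ≤ k) (y : Site d), y ∈ Λ j → CnlZ L U₀ u₁ j (lam₁ - H' X₁) y = X₁ (⟨j, Nat.lt_succ_of_le hj⟩, y))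
    (hzero₂ : ∀ (j : ℕ) (hj : j ≤ k) (y : Site d), y ∉ Λ j → X₂ (⟨j, Nat.lt_succ_of_le hj⟩, y) = 0)
    (hfix₂ : ∀ (j : ℕ) (hj : j ≤ k) (y : Site d), y ∈ Λ j → CnlZ L U₀ u₁ j (lam₂ - H' X₂) y = X₂ (⟨j, Nat.lt_succ_of_le hj⟩, y)) :
    ‖X₁ - X₂‖ ≤ 2 * C2p d * (α₃ + 2 * α₄) * m + (2 * C2p d * (α₃ + 2 * α₄) * B₀') * ‖X₁ - X₂‖ := by
  have hC2 : 0 ≤ C2p d := C2p_nonneg d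
  -- the modulus of `(λ₁ − H′X₁) − (λ₂ − H′X₂) = (λ₁ − λ₂) − H′(X₁ − X₂)` on the towers
  set m' : ℝ := m + B₀' * ‖X₁ - X₂‖ with hm'
  have hm'0 : 0 ≤ m' := by positivity
  have hdiff : lam₁ - H' X₁ - (lam₂ - H' X₂) = (lam₁ - lam₂) - H' (X₁ - X₂) := by rw [map_sub]; abel
  -- the pointwise estimate on `𝔅_k`
  have hkey : ‖X₁ - X₂‖ ≤ C2p d * (2 * m') * (α₃ + 2 * α₄) := by
    refine (BoundedContinuousFunction.norm_le (by positivity)).2 fun p => ?_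
    have hp : ((⟨(p.1 : ℕ), Nat.lt_succ_of_le (Nat.le_of_lt_succ p.1.isLt)⟩ : Fin (k + 1)), p.2) = p :=
      Prod.ext (Fin.ext rfl) rfl
    have hj := Nat.le_of_lt_succ p.1.isLt
    rw [BoundedContinuousFunction.coe_sub, Pi.sub_apply]
    by_cases hy : p.2 ∈ Λ p.1
    · have e₁ := hfix₁ p.1 hj p.2 hy
      have e₂ := hfix₂ p.1 hj p.2 hy
      rw [hp] at e₁ e₂
      rw [← e₁, ← e₂]
      have h2 : 2 * α₄ / 2 = α₄ := by ring
      obtain ⟨hXa, hXb⟩ := dom120_of_119_tower H' hB (by positivity) hH0 (hH1 p.1 hj p.2 hy) (h₁a p.1 hj p.2 hy)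
        (h₁b p.1 hj p.2 hy) hX₁
      obtain ⟨hYa, hYb⟩ := dom120_of_119_tower H' hB (by positivity) hH0 (hH1 p.1 hj p.2 hy) (h₂a p.1 hj p.2 hy)
        (h₂b p.1 hj p.2 hy) hX₂
      have hmb' : ∀ x : Site d, InBox (tlo L p.2 p.1) (thi L p.2 p.1) x → ‖(lam₁ - H' X₁ - (lam₂ - H' X₂)) x‖ ≤ m' := by
        intro x hx
        rw [hdiff, Pi.sub_apply]
        calc ‖(lam₁ - lam₂) x - H' (X₁ - X₂) x‖ ≤ ‖(lam₁ - lam₂) x‖ + ‖H' (X₁ - X₂) x‖ := norm_sub_le _ _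
          _ ≤ m + B₀' * ‖X₁ - X₂‖ := add_le_add (hmb p.1 hj p.2 hy x hx) (hH0 (X₁ - X₂) x)
      have hma' : ∀ (x : Site d) (κ : Fin d), InBox (tlo L p.2 p.1) (thi L p.2 p.1) x →
          InBox (tlo L p.2 p.1) (thi L p.2 p.1) (x + e κ) →
          ‖cj (U₀ x κ) ((lam₁ - H' X₁ - (lam₂ - H' X₂)) (x + e κ)) - (lam₁ - H' X₁ - (lam₂ - H' X₂)) x‖ ≤
            m' * ((L : ℝ) ^ (p.1 : ℕ))⁻¹ := by
        intro x κ hx hxe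
        rw [hdiff, cjDiff_sub]
        calc ‖cj (U₀ x κ) ((lam₁ - lam₂) (x + e κ)) - (lam₁ - lam₂) x -
              (cj (U₀ x κ) (H' (X₁ - X₂) (x + e κ)) - H' (X₁ - X₂) x)‖
            ≤ ‖cj (U₀ x κ) ((lam₁ - lam₂) (x + e κ)) - (lam₁ - lam₂) x‖ +
                ‖cj (U₀ x κ) (H' (X₁ - X₂) (x + e κ)) - H' (X₁ - X₂) x‖ := norm_sub_le _ _
          _ ≤ m * ((L : ℝ) ^ (p.1 : ℕ))⁻¹ + B₀' * ‖X₁ - X₂‖ * ((L : ℝ) ^ (p.1 : ℕ))⁻¹ :=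
              add_le_add (hma p.1 hj p.2 hy x κ hx hxe) (hH1 p.1 hj p.2 hy (X₁ - X₂) x κ hx hxe)
          _ = m' * ((L : ℝ) ^ (p.1 : ℕ))⁻¹ := by rw [hm']; ring
      obtain ⟨ut, hW, hag⟩ := hwit p.1 hj p.2 hy
      exact lipschitz_CnlZ_tower_of_witness hLs hs1 hd hG hU₀ hα hα3 hα4 (h33 p.1 hj p.2 hy) hL1 hW hag (by positivity : 0 < 2 * α₄) hm'0
        (fun x hx => by rw [h2]; exact hXb x hx) (fun x κ hx hxe => by rw [h2]; exact hXa x κ hx hxe)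
        (fun x hx => by rw [h2]; exact hYb x hx) (fun x κ hx hxe => by rw [h2]; exact hYa x κ hx hxe)
        hmb' hma' hα₃ hα₃' hs₁ hs₂ hs₃ hs₄ hs₅ hs₆ hs₇
    · have e₁ := hzero₁ p.1 hj p.2 hy
      have e₂ := hzero₂ p.1 hj p.2 hy
      rw [hp] at e₁ e₂
      rw [e₁, e₂, sub_self, norm_zero]
      positivity
  -- regroup
  have e1 : C2p d * (2 * m') * (α₃ + 2 * α₄) =
      2 * C2p d * (α₃ + 2 * α₄) * m + (2 * C2p d * (α₃ + 2 * α₄) * B₀') * ‖X₁ - X₂‖ := by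
    rw [hm']; ring
  rw [← e1]; exact hkey

/-- **`D′` IS LIPSCHITZ IN `λ` AT `k` LEVELS, WITNESS FORM, under print's smallness «α₃ + α₄ ≦ 1/(4B′₀C′₂)»**: `‖X₁ − X₂‖ ≤ 4·C2p·(α₃ + 2α₄)·m`
(dag-n05-b's `Dprime_lipschitz_kLevel` with the `Λ_j`-witness). [cite: Balaban1985RegularSpaces, p.97 (after (1.125)), (1.117)–(1.122) p.96] -/
theorem Dprime_lipschitz_kLevel_w (hLs : L = 2 * s + 1) (hs1 : 1 ≤ s) (hd : 1 ≤ d) (hL1 : 1 ≤ L) (hG : AvgClosedZ d L G) (hU₀ : ∀ x κ, U₀ x κ ∈ G)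
    (hα : 0 < α₀) (hα3 : C0Z d * α₀ ≤ 1 / 3) (hα4 : 4 * α₀ ≤ c2' d L) (hα₃ : 0 ≤ α₃) (hα₄ : 0 < α₄) (hB : 0 < B₀') (hm : 0 ≤ m)
    (h33 : ∀ j, j ≤ k → ∀ y ∈ Λ j, pdevOn (tlo L y j) (thi L y j) U₀ < α₀ * (((L : ℝ) ^ j)⁻¹) ^ 2)
    (hwit : ∀ j, j ≤ k → ∀ y ∈ Λ j, ∃ ut : Site d → 𝔸ˣ,
      InLambdaZ L (clampCfg (tlo L y j) (thi L y j) U₀) ut j α₃ (((L : ℝ) ^ j)⁻¹) ∧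
      ∀ x : Site d, tlo L y j ≤ x → x ≤ thi L y j → u₁ x = ut x)
    (h₁b : ∀ j, j ≤ k → ∀ y ∈ Λ j, ∀ x : Site d, InBox (tlo L y j) (thi L y j) x → ‖lam₁ x‖ < α₄ / 2)
    (h₁a : ∀ j, j ≤ k → ∀ y ∈ Λ j, ∀ (x : Site d) (κ : Fin d), InBox (tlo L y j) (thi L y j) x →
      InBox (tlo L y j) (thi L y j) (x + e κ) → ‖cj (U₀ x κ) (lam₁ (x + e κ)) - lam₁ x‖ < α₄ / 2 * ((L : ℝ) ^ j)⁻¹)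
    (h₂b : ∀ j, j ≤ k → ∀ y ∈ Λ j, ∀ x : Site d, InBox (tlo L y j) (thi L y j) x → ‖lam₂ x‖ < α₄ / 2)
    (h₂a : ∀ j, j ≤ k → ∀ y ∈ Λ j, ∀ (x : Site d) (κ : Fin d), InBox (tlo L y j) (thi L y j) x →
      InBox (tlo L y j) (thi L y j) (x + e κ) → ‖cj (U₀ x κ) (lam₂ (x + e κ)) - lam₂ x‖ < α₄ / 2 * ((L : ℝ) ^ j)⁻¹)
    (hmb : ∀ j, j ≤ k → ∀ y ∈ Λ j, ∀ x : Site d, InBox (tlo L y j) (thi L y j) x → ‖(lam₁ - lam₂) x‖ ≤ m)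
    (hma : ∀ j, j ≤ k → ∀ y ∈ Λ j, ∀ (x : Site d) (κ : Fin d), InBox (tlo L y j) (thi L y j) x →
      InBox (tlo L y j) (thi L y j) (x + e κ) → ‖cj (U₀ x κ) ((lam₁ - lam₂) (x + e κ)) - (lam₁ - lam₂) x‖ ≤ m * ((L : ℝ) ^ j)⁻¹)
    (hH0 : ∀ (X : XSpace d k 𝔸) (x : Site d), ‖H' X x‖ ≤ B₀' * ‖X‖)
    (hH1 : ∀ j, j ≤ k → ∀ y ∈ Λ j, ∀ (X : XSpace d k 𝔸) (x : Site d) (κ : Fin d), InBox (tlo L y j) (thi L y j) x →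
      InBox (tlo L y j) (thi L y j) (x + e κ) → ‖cj (U₀ x κ) (H' X (x + e κ)) - H' X x‖ ≤ B₀' * ‖X‖ * ((L : ℝ) ^ j)⁻¹)
    (hα₃' : α₃ ≤ 1 / 200) (hs₁ : 200 * C6 d * (2 * α₄) ≤ 1) (hs₂ : 12000 * ((d : ℝ) + 1) * L * (2 * α₄) ≤ 1)
    (hs₃ : C4G d L * (α₀ + α₃ + 4 * (2 * α₄)) ≤ 1)
    (hs₄ : 1024 * ((d : ℝ) + 1) * ((d : ℝ) + 4) * L ^ 2 * α₀ ≤ 1) (hs₅ : 32 * ((d : ℝ) + 1) ^ 2 * C6 d * L ^ 2 * α₀ ≤ 1)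
    (hs₆ : 16 * d * C5' d * C6 d * (L : ℝ) ^ 2 * α₀ ≤ 1) (hs₇ : 8 * d * C6 d * L * α₀ ≤ 1)
    (hsm : α₃ + α₄ ≤ 1 / (4 * B₀' * (2 * C2p d)))
    {X₁ X₂ : XSpace d k 𝔸} (hX₁ : ‖X₁‖ ≤ α₄ / (2 * B₀')) (hX₂ : ‖X₂‖ ≤ α₄ / (2 * B₀'))
    (hzero₁ : ∀ (j : ℕ) (hj : j ≤ k) (y : Site d), y ∉ Λ j → X₁ (⟨j, Nat.lt_succ_of_le hj⟩, y) = 0)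
    (hfix₁ : ∀ (j : ℕ) (hj : j ≤ k) (y : Site d), y ∈ Λ j → CnlZ L U₀ u₁ j (lam₁ - H' X₁) y = X₁ (⟨j, Nat.lt_succ_of_le hj⟩, y))
    (hzero₂ : ∀ (j : ℕ) (hj : j ≤ k) (y : Site d), y ∉ Λ j → X₂ (⟨j, Nat.lt_succ_of_le hj⟩, y) = 0)
    (hfix₂ : ∀ (j : ℕ) (hj : j ≤ k) (y : Site d), y ∈ Λ j → CnlZ L U₀ u₁ j (lam₂ - H' X₂) y = X₂ (⟨j, Nat.lt_succ_of_le hj⟩, y)) :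
    ‖X₁ - X₂‖ ≤ 4 * C2p d * (α₃ + 2 * α₄) * m := by
  have hC2pos : 0 < C2p d := by
    have hC6 : (2 : ℝ) ≤ C6 d := by unfold C6; linarith [one_le_C5 (d := d)]
    unfold C2p Cgen; positivity
  have hkey := Dprime_diff_le_kLevel_w hLs hs1 hd hL1 hG hU₀ hα hα3 hα4 hα₃ hα₄ hB hm h33 hwit h₁b h₁a h₂b h₂a hmb hma hH0 hH1 hα₃' hs₁ hs₂
    hs₃ hs₄ hs₅ hs₆ hs₇ hX₁ hX₂ hzero₁ hfix₁ hzero₂ hfix₂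
  have hhalf := (smallness_prod_w (d := d) hα₃ hB hC2pos hsm).2
  have hXY := norm_nonneg (X₁ - X₂)
  have hk3 : (2 * C2p d * (α₃ + 2 * α₄) * B₀') * ‖X₁ - X₂‖ ≤ 1 / 2 * ‖X₁ - X₂‖ :=
    mul_le_mul_of_nonneg_right hhalf hXY
  linarith only [hkey, hk3]

end Lip

/-! ## §4 `D′` and (1.114) for the INVERSE pair `(·, u₁⁻¹)` of the Theorem-4 knit, from the original pair's regime -/

section Inverse

variable {𝔸 : Type*} [CStarAlgebra 𝔸] [Nontrivial 𝔸]
variable {L s : ℕ} {U₀ : Site d → Fin d → 𝔸ˣ} {k : ℕ} {Λ : ℕ → Set (Site d)} {H' : XSpace d k 𝔸 →ₗ[ℂ] (Site d → 𝔸)}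
  {lam lam₁ lam₂ : Site d → 𝔸} {B : Site d → Fin d → 𝔸} {u₁ : Site d → 𝔸ˣ} {α₀ αP α₄ c B₀' m : ℝ}

/-- **`D′(λ)` AND (1.114) AT `k` LEVELS FOR THE INVERSE `u₁⁻¹` OF THEOREM 4'S INDUCTIVE GAUGE TRANSFORMATION, FROM THE ORIGINAL PAIR'S REGIME**
(route (a″) of the Theorem-4 knit: Sect. E run on the pair `(·, u₁⁻¹)`).  Hypotheses — ALL AT `u₁`, none at `u₁⁻¹`: unitary data; per
`(j, y ∈ Λ_j)` on the tower `Bʲ(y)`: (1.33) for `U₀`, (1.69) `|B_b| ≤ cL^{−j}` (`U₁ = e^{B}` unitary-valued), the plaquette regularity of the full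
field `U₁U₀` ((1.34)-type, `αP`); `U₁^{u₁}U₀ ∈ Ax_k(𝔅_k, U₀)` and (1.29) for `u₁` (`InAx`, `Restr129`); (1.119) for `λ`, the `H′`-modulus,
`Q′H′ = I` on `𝔅_k`; windows (dag-n05-b's at `2α₄` with `α₃ = 40d·c`, this seat's `2048·d·c ≤ 1` and the `αP` Prop-2 window for the unitarity
of the gauge fixing's averages).  THEN there is `X = D′(λ)` for the pair `(·, u₁⁻¹)`: `‖X‖ ≤ α₄/(2B′₀)`, `‖X‖ ≤ C2p(40d·c + α₄)α₄`, `0` off `𝔅_k`,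
`C′_j(u₁⁻¹, λ − H′X)(y) = X(j, y)` and (1.114) `Q′_j(u₁⁻¹, λ − H′X)(y) = (Q′_jλ)(y)` on `𝔅_k`.  The `u₁⁻¹ ∈ Λ`-input is
`B8SectEInLambdaWitness.witness_inv_of_axial` (p05 `inLambda_inv`).
[cite: Balaban1985RegularSpaces, (1.113)–(1.121) pp.95–97, (1.112) p.95, (1.68)–(1.69) p.88, (1.19) p.79, (1.29) p.81; Balaban1985Averaging, Prop. 10 p.50] -/
theorem exists_Dprime_kLevel_inv_of_axial (hLs : L = 2 * s + 1) (hs1 : 1 ≤ s) (hd : 1 ≤ d) (hL1 : 1 ≤ L) (hU₀ : ∀ x κ, U₀ x κ ∈ unitaryUnits 𝔸)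
    (hα : 0 < α₀) (hα3 : C0Z d * α₀ ≤ 1 / 3) (hα4 : 4 * α₀ ≤ c2' d L) (hc : 0 ≤ c) (hα₄ : 0 < α₄) (hB : 0 < B₀')
    (hαP : 0 < αP) (hαP3 : C0Z d * αP ≤ 1 / 3) (hαP2 : 2 * αP ≤ c2' d L)
    (hBu : ∀ (x : Site d) (κ : Fin d), expCfg B x κ ∈ unitaryUnits 𝔸)
    (h33 : ∀ j, j ≤ k → ∀ y ∈ Λ j, pdevOn (tlo L y j) (thi L y j) U₀ < α₀ * (((L : ℝ) ^ j)⁻¹) ^ 2)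
    (h69 : ∀ j, j ≤ k → ∀ y ∈ Λ j, ∀ (x : Site d) (κ : Fin d), InBox (tlo L y j) (thi L y j) x →
      InBox (tlo L y j) (thi L y j) (x + e κ) → ‖B x κ‖ ≤ c * ((L : ℝ) ^ j)⁻¹)
    (hP : ∀ j, j ≤ k → ∀ y ∈ Λ j, pdevOn (tlo L y j) (thi L y j) (expCfg B * U₀) < αP * (((L : ℝ) ^ j)⁻¹) ^ 2)
    (hAx : InAxZ L k Λ U₀ (mgauge U₀ u₁ (expCfg B) * U₀)) (h129 : Restr129Z L k Λ U₀ u₁)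
    (h119b : ∀ j, j ≤ k → ∀ y ∈ Λ j, ∀ x : Site d, InBox (tlo L y j) (thi L y j) x → ‖lam x‖ < α₄ / 2)
    (h119a : ∀ j, j ≤ k → ∀ y ∈ Λ j, ∀ (x : Site d) (κ : Fin d), InBox (tlo L y j) (thi L y j) x →
      InBox (tlo L y j) (thi L y j) (x + e κ) → ‖cj (U₀ x κ) (lam (x + e κ)) - lam x‖ < α₄ / 2 * ((L : ℝ) ^ j)⁻¹)
    (hH0 : ∀ (X : XSpace d k 𝔸) (x : Site d), ‖H' X x‖ ≤ B₀' * ‖X‖)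
    (hH1 : ∀ j, j ≤ k → ∀ y ∈ Λ j, ∀ (X : XSpace d k 𝔸) (x : Site d) (κ : Fin d), InBox (tlo L y j) (thi L y j) x →
      InBox (tlo L y j) (thi L y j) (x + e κ) → ‖cj (U₀ x κ) (H' X (x + e κ)) - H' X x‖ ≤ B₀' * ‖X‖ * ((L : ℝ) ^ j)⁻¹)
    (hQH : ∀ (Y : XSpace d k 𝔸) (j : ℕ) (hj : j ≤ k) (y : Site d), y ∈ Λ j →
      QprimeIter (zdBlockingZ d L) (bgTZ L U₀) j (H' Y) y = Y (⟨j, Nat.lt_succ_of_le hj⟩, y))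
    (hsmall : Real.exp (4 * cZ d * α₀) * (1 + 2 * (131072 * ((d : ℝ) + 1) ^ 2) * (KZ d L) ^ 2 * c) ≤ 2)
    (hc₃ : KZ d L * c ≤ c3 d L) (hsc : 1024 * (d : ℝ) * KZ d L * c ≤ 1) (hα₃' : 20 * d * KZ d L * c ≤ 1 / 200)
    (hs₁ : 200 * C6 d * (2 * α₄) ≤ 1) (hs₂ : 12000 * ((d : ℝ) + 1) * L * (2 * α₄) ≤ 1)
    (hs₃ : C4G d L * (α₀ + 20 * d * KZ d L * c + 4 * (2 * α₄)) ≤ 1)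
    (hs₄ : 1024 * ((d : ℝ) + 1) * ((d : ℝ) + 4) * L ^ 2 * α₀ ≤ 1) (hs₅ : 32 * ((d : ℝ) + 1) ^ 2 * C6 d * L ^ 2 * α₀ ≤ 1)
    (hs₆ : 16 * d * C5' d * C6 d * (L : ℝ) ^ 2 * α₀ ≤ 1) (hs₇ : 8 * d * C6 d * L * α₀ ≤ 1)
    (hsm : 20 * d * KZ d L * c + α₄ ≤ 1 / (4 * B₀' * (2 * C2p d))) :
    ∃ X : XSpace d k 𝔸, ‖X‖ ≤ α₄ / (2 * B₀') ∧ ‖X‖ ≤ C2p d * (20 * d * KZ d L * c + α₄) * α₄ ∧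
      (∀ (j : ℕ) (hj : j ≤ k) (y : Site d), y ∉ Λ j → X (⟨j, Nat.lt_succ_of_le hj⟩, y) = 0) ∧
      (∀ (j : ℕ) (hj : j ≤ k) (y : Site d), y ∈ Λ j →
        CnlZ L U₀ u₁⁻¹ j (lam - H' X) y = X (⟨j, Nat.lt_succ_of_le hj⟩, y)) ∧
      ∀ (j : ℕ), j ≤ k → ∀ y ∈ Λ j,
        QnlZ L U₀ (fun x => expUnit ((lam - H' X) x)) u₁⁻¹ j y = QprimeIter (zdBlockingZ d L) (bgTZ L U₀) j lam y :=
  exists_Dprime_kLevel_w hLs hs1 hd hL1 (avgClosedZ_unitaryUnits d L) hU₀ hα hα3 hα4 (alpha3Z_nonneg L hc) hα₄ hB h33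
    (witness_inv_of_axialZ hLs hs1 hd hU₀ Λ hα hα3 hα4 hc hsmall hc₃ hsc hαP hαP3 hαP2 hL1 hBu h33 h69 hP hAx h129)
    h119b h119a hH0 hH1 hQH hα₃' hs₁ hs₂ hs₃ hs₄ hs₅ hs₆ hs₇ hsm

/-- **`D′` FOR THE INVERSE `u₁⁻¹` IS LIPSCHITZ IN `λ` AT `k` LEVELS**, from the original pair's regime (as `exists_Dprime_kLevel_inv_of_axial`):
`‖X₁ − X₂‖ ≤ 4·C2p·(40d·c + 2α₄)·m` for two solutions in the ball at `λ₁, λ₂` with difference modulus `m` on the towers.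
[cite: Balaban1985RegularSpaces, p.97 (after (1.125)), (1.112) p.95] -/
theorem Dprime_lipschitz_kLevel_inv_of_axial (hLs : L = 2 * s + 1) (hs1 : 1 ≤ s) (hd : 1 ≤ d) (hL1 : 1 ≤ L) (hU₀ : ∀ x κ, U₀ x κ ∈ unitaryUnits 𝔸)
    (hα : 0 < α₀) (hα3 : C0Z d * α₀ ≤ 1 / 3) (hα4 : 4 * α₀ ≤ c2' d L) (hc : 0 ≤ c) (hα₄ : 0 < α₄) (hB : 0 < B₀') (hm : 0 ≤ m)
    (hαP : 0 < αP) (hαP3 : C0Z d * αP ≤ 1 / 3) (hαP2 : 2 * αP ≤ c2' d L)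
    (hBu : ∀ (x : Site d) (κ : Fin d), expCfg B x κ ∈ unitaryUnits 𝔸)
    (h33 : ∀ j, j ≤ k → ∀ y ∈ Λ j, pdevOn (tlo L y j) (thi L y j) U₀ < α₀ * (((L : ℝ) ^ j)⁻¹) ^ 2)
    (h69 : ∀ j, j ≤ k → ∀ y ∈ Λ j, ∀ (x : Site d) (κ : Fin d), InBox (tlo L y j) (thi L y j) x →
      InBox (tlo L y j) (thi L y j) (x + e κ) → ‖B x κ‖ ≤ c * ((L : ℝ) ^ j)⁻¹)
    (hP : ∀ j, j ≤ k → ∀ y ∈ Λ j, pdevOn (tlo L y j) (thi L y j) (expCfg B * U₀) < αP * (((L : ℝ) ^ j)⁻¹) ^ 2)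
    (hAx : InAxZ L k Λ U₀ (mgauge U₀ u₁ (expCfg B) * U₀)) (h129 : Restr129Z L k Λ U₀ u₁)
    (h₁b : ∀ j, j ≤ k → ∀ y ∈ Λ j, ∀ x : Site d, InBox (tlo L y j) (thi L y j) x → ‖lam₁ x‖ < α₄ / 2)
    (h₁a : ∀ j, j ≤ k → ∀ y ∈ Λ j, ∀ (x : Site d) (κ : Fin d), InBox (tlo L y j) (thi L y j) x →
      InBox (tlo L y j) (thi L y j) (x + e κ) → ‖cj (U₀ x κ) (lam₁ (x + e κ)) - lam₁ x‖ < α₄ / 2 * ((L : ℝ) ^ j)⁻¹)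
    (h₂b : ∀ j, j ≤ k → ∀ y ∈ Λ j, ∀ x : Site d, InBox (tlo L y j) (thi L y j) x → ‖lam₂ x‖ < α₄ / 2)
    (h₂a : ∀ j, j ≤ k → ∀ y ∈ Λ j, ∀ (x : Site d) (κ : Fin d), InBox (tlo L y j) (thi L y j) x →
      InBox (tlo L y j) (thi L y j) (x + e κ) → ‖cj (U₀ x κ) (lam₂ (x + e κ)) - lam₂ x‖ < α₄ / 2 * ((L : ℝ) ^ j)⁻¹)
    (hmb : ∀ j, j ≤ k → ∀ y ∈ Λ j, ∀ x : Site d, InBox (tlo L y j) (thi L y j) x → ‖(lam₁ - lam₂) x‖ ≤ m)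
    (hma : ∀ j, j ≤ k → ∀ y ∈ Λ j, ∀ (x : Site d) (κ : Fin d), InBox (tlo L y j) (thi L y j) x →
      InBox (tlo L y j) (thi L y j) (x + e κ) → ‖cj (U₀ x κ) ((lam₁ - lam₂) (x + e κ)) - (lam₁ - lam₂) x‖ ≤ m * ((L : ℝ) ^ j)⁻¹)
    (hH0 : ∀ (X : XSpace d k 𝔸) (x : Site d), ‖H' X x‖ ≤ B₀' * ‖X‖)
    (hH1 : ∀ j, j ≤ k → ∀ y ∈ Λ j, ∀ (X : XSpace d k 𝔸) (x : Site d) (κ : Fin d), InBox (tlo L y j) (thi L y j) x →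
      InBox (tlo L y j) (thi L y j) (x + e κ) → ‖cj (U₀ x κ) (H' X (x + e κ)) - H' X x‖ ≤ B₀' * ‖X‖ * ((L : ℝ) ^ j)⁻¹)
    (hsmall : Real.exp (4 * cZ d * α₀) * (1 + 2 * (131072 * ((d : ℝ) + 1) ^ 2) * (KZ d L) ^ 2 * c) ≤ 2)
    (hc₃ : KZ d L * c ≤ c3 d L) (hsc : 1024 * (d : ℝ) * KZ d L * c ≤ 1) (hα₃' : 20 * d * KZ d L * c ≤ 1 / 200)
    (hs₁ : 200 * C6 d * (2 * α₄) ≤ 1) (hs₂ : 12000 * ((d : ℝ) + 1) * L * (2 * α₄) ≤ 1)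
    (hs₃ : C4G d L * (α₀ + 20 * d * KZ d L * c + 4 * (2 * α₄)) ≤ 1)
    (hs₄ : 1024 * ((d : ℝ) + 1) * ((d : ℝ) + 4) * L ^ 2 * α₀ ≤ 1) (hs₅ : 32 * ((d : ℝ) + 1) ^ 2 * C6 d * L ^ 2 * α₀ ≤ 1)
    (hs₆ : 16 * d * C5' d * C6 d * (L : ℝ) ^ 2 * α₀ ≤ 1) (hs₇ : 8 * d * C6 d * L * α₀ ≤ 1)
    (hsm : 20 * d * KZ d L * c + α₄ ≤ 1 / (4 * B₀' * (2 * C2p d)))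
    {X₁ X₂ : XSpace d k 𝔸} (hX₁ : ‖X₁‖ ≤ α₄ / (2 * B₀')) (hX₂ : ‖X₂‖ ≤ α₄ / (2 * B₀'))
    (hzero₁ : ∀ (j : ℕ) (hj : j ≤ k) (y : Site d), y ∉ Λ j → X₁ (⟨j, Nat.lt_succ_of_le hj⟩, y) = 0)
    (hfix₁ : ∀ (j : ℕ) (hj : j ≤ k) (y : Site d), y ∈ Λ j → CnlZ L U₀ u₁⁻¹ j (lam₁ - H' X₁) y = X₁ (⟨j, Nat.lt_succ_of_le hj⟩, y))
    (hzero₂ : ∀ (j : ℕ) (hj : j ≤ k) (y : Site d), y ∉ Λ j → X₂ (⟨j, Nat.lt_succ_of_le hj⟩, y) = 0)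
    (hfix₂ : ∀ (j : ℕ) (hj : j ≤ k) (y : Site d), y ∈ Λ j → CnlZ L U₀ u₁⁻¹ j (lam₂ - H' X₂) y = X₂ (⟨j, Nat.lt_succ_of_le hj⟩, y)) :
    ‖X₁ - X₂‖ ≤ 4 * C2p d * (20 * d * KZ d L * c + 2 * α₄) * m :=
  Dprime_lipschitz_kLevel_w hLs hs1 hd hL1 (avgClosedZ_unitaryUnits d L) hU₀ hα hα3 hα4 (alpha3Z_nonneg L hc) hα₄ hB hm h33
    (witness_inv_of_axialZ hLs hs1 hd hU₀ Λ hα hα3 hα4 hc hsmall hc₃ hsc hαP hαP3 hαP2 hL1 hBu h33 h69 hP hAx h129)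
    h₁b h₁a h₂b h₂a hmb hma hH0 hH1 hα₃' hs₁ hs₂ hs₃ hs₄ hs₅ hs₆ hs₇ hsm hX₁ hX₂ hzero₁ hfix₁ hzero₂ hfix₂

end Inverse

end Literature.MathematicalPhysics.QuantumFieldTheory.Balaban1983to89.B8SectEKLevelInLambdaRec

end
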